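import Mathlib.MeasureTheory.Constructions.HaarToSphere
import Mathlib.MeasureTheory.Measure.Lebesgue.VolumeOfBalls
import Mathlib.MeasureTheory.Integral.IntegralEqImproper
import Mathlib.MeasureTheory.Measure.Haar.InnerProductSpace
import Mathlib.MeasureTheory.Measure.Haar.Unique
import Mathlib.MeasureTheory.Group.Integral
import Mathlib.Analysis.InnerProductSpace.Projection.Reflection
import Mathlib.Analysis.InnerProductSpace.Calculus
import Mathlib.Analysis.Calculus.LineDeriv.Basic
import HarnessLib

/-!
# The information (Fisher–Rao) metric of the BPST instanton densities on `ℝ⁴` is hyperbolic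

Topic `Literature/Geometry/GaugeTheory` (companion of `InstantonCollarInformationMetric.lean`).

The curvature density of the charge-one (anti-)self-dual `SU(2)` connection on flat `ℝ⁴` with
centre `a` and scale `λ` — the BPST instanton — is
`ρ_{a,λ}(x) = |F|²(x) = 48 λ⁴ / (λ² + ‖x − a‖²)⁴` (Naber 1997, §5.3, (5.3.4): `‖F(q)‖² = 48/(1+|q|²)⁴`
for `λ = 1`, `a = 0`, in the norm `|ξ|² = −tr ξ²` on `𝔰𝔭(1)`; Groisser–Murray 1997, §3, p. 7:
`|F_{0,λ}| = √48 λ²/(λ² + r²)²`), of total mass `8π²`.  Groisser–Murray's proof of their Theorem 3.1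
(the information metric of a collared charge-one moduli space is `C⁰`-asymptotic to
`(128π²/5)(dλ² + g_M)/λ²`) reduces, on the ball `B_{Nλ}(p)` in normal coordinates, to the flat-space
computation for this five-parameter family: writing `X = (𝐚, a₀ ∂_λ)`,
`∫_{ℝ⁴} (∂_X ρ)²/ρ d⁴x = 16·48·2π² λ⁻² ∫₀^∞ ρ³ (a₀²(1−ρ²)² + |𝐚|²ρ²)/(1+ρ²)⁶ dρ`, and "both
integrals converge to `1/60`", whence the constant `16·48·2π²/60 = 128π²/5` (GM 1997, §3, proof of
Thm. 3.1, Part I, interior estimates).  Equivalently (Hitchin; GM 1997 §2): the information metric of the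
charge-one moduli space `B⁵ = ℝ⁴ × ℝ₊` of `S⁴ ⊃ ℝ⁴` is the hyperbolic metric `c (d𝐚² + dλ²)/λ²`.

This file PROVES the flat-space statement exactly:

* `bpstDensity a l x = 48 l⁴ / (l² + ‖x − a‖²)⁴` on `EuclideanSpace ℝ (Fin 4)`; `bpstDensity_pos`,
  `bpstDensity_le` / `bpstDensity_self` (`sup ρ = 48/λ⁴`, concentration as `λ → 0`),
  `integral_bpstDensity` (`∫ ρ = 8π²`);
* `fderiv_bpstDensity`: `∂_{(v,s)} ρ_{a,λ}(x) = 192 λ³ (s(‖y‖² − λ²) + 2λ⟪y, v⟫)/(λ² + ‖y‖²)⁵`, `y = x − a`;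
* `integral_fisherRao_bpstDensity` (the main statement):
  `∫ (∂_{(v,s)} ρ)² / ρ d⁴x = (128π²/5) (s² + ‖v‖²)/λ²` for every `λ > 0`, `v ∈ ℝ⁴`, `s ∈ ℝ`;

through the elementary inputs of GM's computation, also proved here: polar coordinates on `ℝ⁴`
(`integral_radial_four`: `∫ f(‖x‖) d⁴x = 2π² ∫₀^∞ r³ f(r) dr`), the three radial integrals
`∫₀^∞ r³/(λ²+r²)⁴ = 1/(12λ⁴)`, `∫₀^∞ r³(r²−λ²)²/(λ²+r²)⁶ = 1/(60λ⁴)`, `∫₀^∞ r⁵/(λ²+r²)⁶ = 1/(60λ⁶)`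
(explicit primitives), oddness `∫ h(‖x‖)⟪x, v⟫ = 0` and isotropy
`∫ g(‖x‖)⟪x, v⟫² = ‖v‖²/4 ∫ g(‖x‖)‖x‖²` (reflection symmetry of Lebesgue measure).

What is NOT here: anything about curved base manifolds or the moduli space `M₁` itself (the cited
fact `informationMetric_collarAsymptotics` of `InstantonCollarInformationMetric.lean`, whose interior
main term this is).

## References

* [GroisserMurray1997] D. Groisser, M. K. Murray, *Instantons and the information metric*, Ann.
  Global Anal. Geom. 15 (1997) 519–537, §2 p. 5 (hyperbolic metric on `B⁵`), §3 proof of Thm. 3.1,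
  p. 7 (interior estimate, the integrals `= 1/60`, the constant `128π²/5`).
* [Naber1997] G. L. Naber, *Topology, Geometry, and Gauge Fields* (1997), §5.3, (5.3.4)–(5.3.8)
  (the BPST density `48/(1+|q|²)⁴`, action `8π²`).
-/

noncomputable section

open scoped RealInnerProductSpace
open Set Filter Real
open _root_.MeasureTheory _root_.Topology

namespace Literature.Geometry.GaugeTheory

/-- Local notation: the model space `ℝ⁴`. -/
local notation "E4" => EuclideanSpace ℝ (Fin 4)

namespace BPST

/-! ### Three radial integrals (Groisser–Murray 1997, p. 7: "both converge to `1/60`") -/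

section OneDim

variable {l : ℝ}

/-- `d/dr (l² + r²)⁻¹ = −2r (l² + r²)⁻²`. [folklore] -/
theorem hasDerivAt_invSq (hl : l ≠ 0) (r : ℝ) :
    HasDerivAt (fun r : ℝ ↦ (l ^ 2 + r ^ 2)⁻¹) (-(2 * r) / (l ^ 2 + r ^ 2) ^ 2) r := by
  have h1 : HasDerivAt (fun r : ℝ ↦ l ^ 2 + r ^ 2) (2 * r) r := by
    simpa using (hasDerivAt_pow 2 r).const_add (l ^ 2)
  exact h1.inv (by positivity)

/-- `(l² + r²)⁻¹ → 0` as `r → ∞`. [folklore] -/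
theorem tendsto_invSq (l : ℝ) : Tendsto (fun r : ℝ ↦ (l ^ 2 + r ^ 2)⁻¹) atTop (𝓝 0) :=
  tendsto_inv_atTop_zero.comp (tendsto_atTop_add_const_left _ _ (tendsto_pow_atTop two_ne_zero))

/-- A primitive of `r³/(l² + r²)⁴`: `−(l²+r²)⁻²/4 + l²(l²+r²)⁻³/6`. [folklore] -/
theorem hasDerivAt_massPrim (hl : l ≠ 0) (r : ℝ) :
    HasDerivAt (fun r : ℝ ↦ -(l ^ 2 + r ^ 2)⁻¹ ^ 2 / 4 + l ^ 2 * (l ^ 2 + r ^ 2)⁻¹ ^ 3 / 6)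
      (r ^ 3 / (l ^ 2 + r ^ 2) ^ 4) r := by
  have hw := hasDerivAt_invSq hl r
  have hu : l ^ 2 + r ^ 2 ≠ 0 := by positivity
  refine (((hw.fun_pow 2).fun_neg.div_const 4).fun_add
    (((hw.fun_pow 3).const_mul (l ^ 2)).div_const 6)).congr_deriv ?_
  norm_num
  field_simp
  ring

/-- The primitive of `r³/(l² + r²)⁴` tends to `0` at `∞`. [folklore] -/
theorem tendsto_massPrim (l : ℝ) :
    Tendsto (fun r : ℝ ↦ -(l ^ 2 + r ^ 2)⁻¹ ^ 2 / 4 + l ^ 2 * (l ^ 2 + r ^ 2)⁻¹ ^ 3 / 6)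
      atTop (𝓝 0) := by
  have h := tendsto_invSq l
  simpa using (((h.pow 2).neg.div_const 4).add (((h.pow 3).const_mul (l ^ 2)).div_const 6))

/-- `∫₀^∞ r³/(l²+r²)⁴ dr = 1/(12 l⁴)` (the total mass `8π²` of the BPST density). [folklore] -/
theorem integral_mass (hl : 0 < l) :
    ∫ r in Ioi (0 : ℝ), r ^ 3 / (l ^ 2 + r ^ 2) ^ 4 = 1 / (12 * l ^ 4) := by
  have hl0 : l ≠ 0 := hl.ne'
  rw [integral_Ioi_of_hasDerivAt_of_nonneg' (fun r _ ↦ hasDerivAt_massPrim hl0 r)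
    (fun r hr ↦ div_nonneg (pow_nonneg (le_of_lt hr) 3) (by positivity)) (tendsto_massPrim l)]
  norm_num
  field_simp
  ring

/-- `r³/(l²+r²)⁴` is integrable on `(0, ∞)`. [folklore] -/
theorem integrableOn_mass (hl : 0 < l) :
    IntegrableOn (fun r : ℝ ↦ r ^ 3 / (l ^ 2 + r ^ 2) ^ 4) (Ioi 0) :=
  integrableOn_Ioi_deriv_of_nonneg' (fun r _ ↦ hasDerivAt_massPrim hl.ne' r)
    (fun r hr ↦ div_nonneg (pow_nonneg (le_of_lt hr) 3) (by positivity)) (tendsto_massPrim l)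

/-- A primitive of `r³(r²−l²)²/(l²+r²)⁶`. [folklore] -/
theorem hasDerivAt_radialPrim (hl : l ≠ 0) (r : ℝ) :
    HasDerivAt (fun r : ℝ ↦ (-(l ^ 2 + r ^ 2)⁻¹ ^ 2 / 2 + 5 * l ^ 2 * (l ^ 2 + r ^ 2)⁻¹ ^ 3 / 3
        - 2 * l ^ 4 * (l ^ 2 + r ^ 2)⁻¹ ^ 4 + 4 * l ^ 6 * (l ^ 2 + r ^ 2)⁻¹ ^ 5 / 5) / 2)
      (r ^ 3 * ((r ^ 2 - l ^ 2) ^ 2 / (l ^ 2 + r ^ 2) ^ 6)) r := by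
  have hw := hasDerivAt_invSq hl r
  have hu : l ^ 2 + r ^ 2 ≠ 0 := by positivity
  refine ((((((hw.fun_pow 2).fun_neg.div_const 2).fun_add
    (((hw.fun_pow 3).const_mul (5 * l ^ 2)).div_const 3)).fun_sub
    ((hw.fun_pow 4).const_mul (2 * l ^ 4))).fun_add
    (((hw.fun_pow 5).const_mul (4 * l ^ 6)).div_const 5)).div_const 2).congr_deriv ?_
  norm_num
  field_simp
  ring

/-- The primitive of `r³(r²−l²)²/(l²+r²)⁶` tends to `0` at `∞`. [folklore] -/
theorem tendsto_radialPrim (l : ℝ) :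
    Tendsto (fun r : ℝ ↦ (-(l ^ 2 + r ^ 2)⁻¹ ^ 2 / 2 + 5 * l ^ 2 * (l ^ 2 + r ^ 2)⁻¹ ^ 3 / 3
        - 2 * l ^ 4 * (l ^ 2 + r ^ 2)⁻¹ ^ 4 + 4 * l ^ 6 * (l ^ 2 + r ^ 2)⁻¹ ^ 5 / 5) / 2)
      atTop (𝓝 0) := by
  have h := tendsto_invSq l
  simpa using (((((h.pow 2).neg.div_const 2).add (((h.pow 3).const_mul (5 * l ^ 2)).div_const 3)).sub
    ((h.pow 4).const_mul (2 * l ^ 4))).add (((h.pow 5).const_mul (4 * l ^ 6)).div_const 5)).div_const 2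

/-- **GM 1997, p. 7, first integral:** `∫₀^∞ r³(r²−l²)²/(l²+r²)⁶ dr = 1/(60 l⁴)` (for `l = 1`:
`∫₀^∞ ρ³(1−ρ²)²/(1+ρ²)⁶ dρ = 1/60`). [cite: GroisserMurray1997, §3 proof of Thm. 3.1, p. 7] -/
theorem integral_radial_sq (hl : 0 < l) :
    ∫ r in Ioi (0 : ℝ), r ^ 3 * ((r ^ 2 - l ^ 2) ^ 2 / (l ^ 2 + r ^ 2) ^ 6) = 1 / (60 * l ^ 4) := by
  have hl0 : l ≠ 0 := hl.ne'
  rw [integral_Ioi_of_hasDerivAt_of_nonneg' (fun r _ ↦ hasDerivAt_radialPrim hl0 r)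
    (fun r hr ↦ mul_nonneg (pow_nonneg (le_of_lt hr) 3) (by positivity)) (tendsto_radialPrim l)]
  norm_num
  field_simp
  ring

/-- `r³(r²−l²)²/(l²+r²)⁶` is integrable on `(0, ∞)`. [folklore] -/
theorem integrableOn_radial_sq (hl : 0 < l) :
    IntegrableOn (fun r : ℝ ↦ r ^ 3 * ((r ^ 2 - l ^ 2) ^ 2 / (l ^ 2 + r ^ 2) ^ 6)) (Ioi 0) :=
  integrableOn_Ioi_deriv_of_nonneg' (fun r _ ↦ hasDerivAt_radialPrim hl.ne' r)
    (fun r hr ↦ mul_nonneg (pow_nonneg (le_of_lt hr) 3) (by positivity)) (tendsto_radialPrim l)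

/-- A primitive of `r⁵/(l²+r²)⁶ = r³ · ((l²+r²)⁶)⁻¹ r²`. [folklore] -/
theorem hasDerivAt_momentPrim (hl : l ≠ 0) (r : ℝ) :
    HasDerivAt (fun r : ℝ ↦ (-(l ^ 2 + r ^ 2)⁻¹ ^ 3 / 3 + l ^ 2 * (l ^ 2 + r ^ 2)⁻¹ ^ 4 / 2
        - l ^ 4 * (l ^ 2 + r ^ 2)⁻¹ ^ 5 / 5) / 2)
      (r ^ 3 * (((l ^ 2 + r ^ 2) ^ 6)⁻¹ * r ^ 2)) r := by
  have hw := hasDerivAt_invSq hl r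
  have hu : l ^ 2 + r ^ 2 ≠ 0 := by positivity
  refine (((((hw.fun_pow 3).fun_neg.div_const 3).fun_add
    (((hw.fun_pow 4).const_mul (l ^ 2)).div_const 2)).fun_sub
    (((hw.fun_pow 5).const_mul (l ^ 4)).div_const 5)).div_const 2).congr_deriv ?_
  norm_num
  field_simp
  ring

/-- The primitive of `r⁵/(l²+r²)⁶` tends to `0` at `∞`. [folklore] -/
theorem tendsto_momentPrim (l : ℝ) :
    Tendsto (fun r : ℝ ↦ (-(l ^ 2 + r ^ 2)⁻¹ ^ 3 / 3 + l ^ 2 * (l ^ 2 + r ^ 2)⁻¹ ^ 4 / 2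
        - l ^ 4 * (l ^ 2 + r ^ 2)⁻¹ ^ 5 / 5) / 2) atTop (𝓝 0) := by
  have h := tendsto_invSq l
  simpa using ((((h.pow 3).neg.div_const 3).add (((h.pow 4).const_mul (l ^ 2)).div_const 2)).sub
    (((h.pow 5).const_mul (l ^ 4)).div_const 5)).div_const 2

/-- **GM 1997, p. 7, second integral:** `∫₀^∞ r⁵/(l²+r²)⁶ dr = 1/(60 l⁶)` (for `l = 1`:
`∫₀^∞ ρ⁵/(1+ρ²)⁶ dρ = 1/60`). [cite: GroisserMurray1997, §3 proof of Thm. 3.1, p. 7] -/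
theorem integral_moment (hl : 0 < l) :
    ∫ r in Ioi (0 : ℝ), r ^ 3 * (((l ^ 2 + r ^ 2) ^ 6)⁻¹ * r ^ 2) = 1 / (60 * l ^ 6) := by
  have hl0 : l ≠ 0 := hl.ne'
  rw [integral_Ioi_of_hasDerivAt_of_nonneg' (fun r _ ↦ hasDerivAt_momentPrim hl0 r)
    (fun r hr ↦ mul_nonneg (pow_nonneg (le_of_lt hr) 3) (by positivity)) (tendsto_momentPrim l)]
  norm_num
  field_simp
  ring

/-- `r⁵/(l²+r²)⁶` is integrable on `(0, ∞)`. [folklore] -/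
theorem integrableOn_moment (hl : 0 < l) :
    IntegrableOn (fun r : ℝ ↦ r ^ 3 * (((l ^ 2 + r ^ 2) ^ 6)⁻¹ * r ^ 2)) (Ioi 0) :=
  integrableOn_Ioi_deriv_of_nonneg' (fun r _ ↦ hasDerivAt_momentPrim hl.ne' r)
    (fun r hr ↦ mul_nonneg (pow_nonneg (le_of_lt hr) 3) (by positivity)) (tendsto_momentPrim l)

end OneDim

/-! ### Polar coordinates and reflection symmetries on `ℝ⁴` -/

/-- The volume of the unit ball of `ℝ⁴` is `π²/2`. [folklore] -/
theorem volume_real_ball_four : (volume : Measure E4).real (Metric.ball 0 1) = π ^ 2 / 2 := by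
  have hk : Module.finrank ℝ E4 = 2 * 2 := by rw [finrank_euclideanSpace_fin]
  rw [measureReal_def, InnerProductSpace.volume_ball_of_dim_even hk, finrank_euclideanSpace_fin,
    ENNReal.toReal_mul, ENNReal.ofReal_one, one_pow, ENNReal.toReal_one, one_mul,
    ENNReal.toReal_ofReal (by positivity), Nat.factorial_two]
  norm_num

/-- **Polar coordinates on `ℝ⁴`:** `∫ f(‖x‖) d⁴x = 2π² ∫₀^∞ r³ f(r) dr` (`Vol(S³) = 2π²`; both sides
are `0` when either is not integrable). [folklore] -/
theorem integral_radial_four (f : ℝ → ℝ) :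
    ∫ x : E4, f ‖x‖ = 2 * π ^ 2 * ∫ r in Ioi (0 : ℝ), r ^ 3 * f r := by
  rw [integral_fun_norm_addHaar (volume : Measure E4) f, finrank_euclideanSpace_fin,
    volume_real_ball_four]
  simp only [nsmul_eq_mul, smul_eq_mul, Nat.cast_ofNat, Nat.reduceSub]
  ring

/-- Integrability in polar coordinates on `ℝ⁴`: `f(‖x‖)` is integrable iff `r³ f(r)` is integrable
on `(0, ∞)`. [folklore] -/
theorem integrable_radial_four_iff (f : ℝ → ℝ) :
    Integrable (fun x : E4 ↦ f ‖x‖) ↔ IntegrableOn (fun r : ℝ ↦ r ^ 3 * f r) (Ioi 0) := by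
  have h := integrable_fun_norm_addHaar (volume : Measure E4) (f := f)
  rw [finrank_euclideanSpace_fin] at h
  simpa only [smul_eq_mul, Nat.reduceSub] using h

/-- **Oddness:** `∫ h(‖x‖) ⟪x, v⟫ d⁴x = 0` (the substitution `x ↦ −x` preserves Lebesgue measure).
[folklore] -/
theorem integral_norm_mul_inner_eq_zero (h : ℝ → ℝ) (v : E4) :
    ∫ x : E4, h ‖x‖ * ⟪x, v⟫ = 0 := by
  have h1 := integral_neg_eq_self (fun x : E4 ↦ h ‖x‖ * ⟪x, v⟫) volume
  simp only [norm_neg, inner_neg_left, mul_neg, integral_neg] at h1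
  linarith

/-- Invariance of `v ↦ ∫ g(‖x‖)⟪x, v⟫²` under linear isometries (change of variables). [folklore] -/
theorem integral_norm_mul_inner_sq_map (g : ℝ → ℝ) (R : E4 ≃ₗᵢ[ℝ] E4) (w : E4) :
    ∫ x : E4, g ‖x‖ * ⟪x, R w⟫ ^ 2 = ∫ x : E4, g ‖x‖ * ⟪x, w⟫ ^ 2 := by
  rw [← R.measurePreserving.integral_comp R.toHomeomorph.measurableEmbedding
    (fun x : E4 ↦ g ‖x‖ * ⟪x, R w⟫ ^ 2)]
  simp only [LinearIsometryEquiv.norm_map, LinearIsometryEquiv.inner_map_map]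

/-- `∫ g(‖x‖)⟪x, w⟫²` depends only on `‖w‖` (a reflection maps `w` to any `w'` of the same norm).
[folklore] -/
theorem integral_norm_mul_inner_sq_eq_of_norm_eq (g : ℝ → ℝ) {w w' : E4} (h : ‖w‖ = ‖w'‖) :
    ∫ x : E4, g ‖x‖ * ⟪x, w⟫ ^ 2 = ∫ x : E4, g ‖x‖ * ⟪x, w'⟫ ^ 2 := by
  have hR : (Submodule.span ℝ {w - w'})ᗮ.reflection w = w' := Submodule.reflection_sub h
  conv_rhs => rw [← hR]
  exact (integral_norm_mul_inner_sq_map g _ w).symm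

/-- **Isotropy:** `∫ g(‖x‖)⟪x, v⟫² d⁴x = ‖v‖²/4 · ∫ g(‖x‖)‖x‖² d⁴x` (the second moments of a
radial density are `1/4` of the trace in each direction). [folklore] -/
theorem integral_norm_mul_inner_sq (g : ℝ → ℝ) (hg : Continuous g) (v : E4)
    (hint : Integrable (fun x : E4 ↦ g ‖x‖ * ‖x‖ ^ 2)) :
    ∫ x : E4, g ‖x‖ * ⟪x, v⟫ ^ 2 = ‖v‖ ^ 2 / 4 * ∫ x : E4, g ‖x‖ * ‖x‖ ^ 2 := by
  -- in the direction of a coordinate vector of length `‖v‖`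
  have hb : ∀ i : Fin 4, ∫ x : E4, g ‖x‖ * ⟪x, v⟫ ^ 2 = ‖v‖ ^ 2 * ∫ x : E4, g ‖x‖ * (x i) ^ 2 := by
    intro i
    have hn : ‖v‖ = ‖(‖v‖ • EuclideanSpace.single i (1 : ℝ) : E4)‖ := by
      rw [norm_smul, PiLp.norm_single, norm_one, mul_one, norm_norm]
    rw [integral_norm_mul_inner_sq_eq_of_norm_eq g hn, ← integral_const_mul]
    refine integral_congr_ae (ae_of_all _ fun x ↦ ?_)
    simp only [inner_smul_right, EuclideanSpace.inner_single_right, conj_trivial, one_mul]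
    ring
  -- each coordinate moment is integrable
  have hi : ∀ i : Fin 4, Integrable (fun x : E4 ↦ g ‖x‖ * (x i) ^ 2) := by
    intro i
    refine hint.norm.mono' ((hg.comp continuous_norm).mul
      ((PiLp.continuous_apply (p := 2) (β := fun _ : Fin 4 ↦ ℝ) i).pow 2)).aestronglyMeasurable
      (ae_of_all _ fun x ↦ ?_)
    rw [Real.norm_eq_abs, Real.norm_eq_abs, abs_mul, abs_mul, abs_of_nonneg (sq_nonneg (x i)),
      abs_of_nonneg (sq_nonneg ‖x‖)]
    refine mul_le_mul_of_nonneg_left ?_ (abs_nonneg _)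
    rw [EuclideanSpace.real_norm_sq_eq]
    exact Finset.single_le_sum (f := fun j ↦ (x j) ^ 2) (fun j _ ↦ sq_nonneg _) (Finset.mem_univ i)
  -- sum over the four coordinates
  have hsum : (4 : ℝ) * ∫ x : E4, g ‖x‖ * ⟪x, v⟫ ^ 2 = ‖v‖ ^ 2 * ∫ x : E4, g ‖x‖ * ‖x‖ ^ 2 := by
    calc (4 : ℝ) * ∫ x : E4, g ‖x‖ * ⟪x, v⟫ ^ 2
        = ∑ _i : Fin 4, ∫ x : E4, g ‖x‖ * ⟪x, v⟫ ^ 2 := by simp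
      _ = ∑ i : Fin 4, ‖v‖ ^ 2 * ∫ x : E4, g ‖x‖ * (x i) ^ 2 := Finset.sum_congr rfl fun i _ ↦ hb i
      _ = ‖v‖ ^ 2 * ∫ x : E4, ∑ i : Fin 4, g ‖x‖ * (x i) ^ 2 := by
          rw [← Finset.mul_sum, integral_finsetSum _ fun i _ ↦ hi i]
      _ = ‖v‖ ^ 2 * ∫ x : E4, g ‖x‖ * ‖x‖ ^ 2 := by
          congr 1
          refine integral_congr_ae (ae_of_all _ fun x ↦ ?_)
          dsimp only
          rw [EuclideanSpace.real_norm_sq_eq, Finset.mul_sum]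
  linarith

end BPST

/-! ### The BPST density family and its Fisher–Rao form -/

open BPST

/-- **The BPST (charge-one instanton) curvature density on `ℝ⁴`** with centre `a` and scale `l`:
`ρ_{a,l}(x) = |F|²(x) = 48 l⁴/(l² + ‖x − a‖²)⁴` (Naber 1997, (5.3.4), in the norm `|ξ|² = −tr ξ²`;
Groisser–Murray 1997, p. 7, `|F_{0,λ}|² = 48λ⁴/(λ²+r²)⁴`). Meaningful for `l ≠ 0`.
[cite: Naber1997, §5.3 (5.3.4)] -/
def bpstDensity (a : E4) (l : ℝ) (x : E4) : ℝ :=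
  48 * l ^ 4 / (l ^ 2 + ‖x - a‖ ^ 2) ^ 4

/-- Unfolding `bpstDensity`. [folklore] -/
theorem bpstDensity_apply (a : E4) (l : ℝ) (x : E4) :
    bpstDensity a l x = 48 * l ^ 4 / (l ^ 2 + ‖x - a‖ ^ 2) ^ 4 := rfl

/-- The BPST density is positive (for `l ≠ 0`). [folklore] -/
theorem bpstDensity_pos (a : E4) {l : ℝ} (hl : l ≠ 0) (x : E4) : 0 < bpstDensity a l x := by
  unfold bpstDensity; positivity

/-- The BPST density at its centre: `ρ_{a,l}(a) = 48/l⁴`. [folklore] -/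
theorem bpstDensity_self (a : E4) {l : ℝ} (hl : l ≠ 0) : bpstDensity a l a = 48 / l ^ 4 := by
  unfold bpstDensity
  rw [sub_self, norm_zero]
  field_simp
  ring

/-- **Concentration:** `ρ_{a,l} ≤ 48/l⁴ = ρ_{a,l}(a)`, so `sup ρ_{a,l} = 48 l⁻⁴ → ∞` as `l → 0`.
[folklore] -/
theorem bpstDensity_le (a : E4) {l : ℝ} (hl : l ≠ 0) (x : E4) : bpstDensity a l x ≤ 48 / l ^ 4 := by
  unfold bpstDensity
  have hl4 : 0 < l ^ 4 := by positivity
  rw [div_le_div_iff₀ (by positivity) hl4]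
  have h : l ^ 4 * l ^ 4 ≤ (l ^ 2 + ‖x - a‖ ^ 2) ^ 4 := by
    calc l ^ 4 * l ^ 4 = (l ^ 2) ^ 4 := by ring
      _ ≤ (l ^ 2 + ‖x - a‖ ^ 2) ^ 4 :=
        pow_le_pow_left₀ (sq_nonneg l) (le_add_of_nonneg_right (sq_nonneg _)) 4
  nlinarith [h]

/-- **Total mass `8π²`:** `∫_{ℝ⁴} ρ_{a,l} d⁴x = 48 · 2π² · l⁴ ∫₀^∞ r³/(l²+r²)⁴ dr = 8π²` (the action
of a charge-one instanton; Naber 1997, (5.3.7)–(5.3.8)). [cite: Naber1997, §5.3 (5.3.7)–(5.3.8)] -/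
theorem integral_bpstDensity (a : E4) {l : ℝ} (hl : 0 < l) : ∫ x : E4, bpstDensity a l x = 8 * π ^ 2 := by
  have htr : ∀ x : E4, bpstDensity a l x =
      (fun y : E4 ↦ 48 * l ^ 4 / (l ^ 2 + ‖y‖ ^ 2) ^ 4) (-a + x) := by
    intro x
    simp only [bpstDensity, neg_add_eq_sub]
  simp_rw [htr]
  have htrans := integral_add_left_eq_self (μ := (volume : Measure E4))
    (fun y : E4 ↦ 48 * l ^ 4 / (l ^ 2 + ‖y‖ ^ 2) ^ 4) (-a)
  rw [htrans]
  have h := integral_radial_four (fun r ↦ 48 * l ^ 4 / (l ^ 2 + r ^ 2) ^ 4)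
  rw [h]
  have h2 : ∫ r in Ioi (0 : ℝ), r ^ 3 * (48 * l ^ 4 / (l ^ 2 + r ^ 2) ^ 4) =
      48 * l ^ 4 * ∫ r in Ioi (0 : ℝ), r ^ 3 / (l ^ 2 + r ^ 2) ^ 4 := by
    rw [← integral_const_mul]
    refine integral_congr_ae (ae_of_all _ fun r ↦ ?_)
    ring
  rw [h2, integral_mass hl]
  field_simp
  ring

/-- `p ↦ ρ_{p.1, p.2}(x)` is differentiable at `(a, l)` for `l ≠ 0`. [folklore] -/
theorem differentiableAt_bpstDensity (a x : E4) {l : ℝ} (hl : l ≠ 0) :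
    DifferentiableAt ℝ (fun p : E4 × ℝ ↦ bpstDensity p.1 p.2 x) (a, l) := by
  have h1 : DifferentiableAt ℝ (fun p : E4 × ℝ ↦ p.2 ^ 2 + ‖x - p.1‖ ^ 2) (a, l) :=
    ((differentiableAt_snd (𝕜 := ℝ)).fun_pow 2).fun_add
      (((differentiableAt_const x).sub differentiableAt_fst).norm_sq ℝ)
  have h0 : (l ^ 2 + ‖x - a‖ ^ 2) ^ 4 ≠ 0 := by positivity
  simp only [bpstDensity, div_eq_mul_inv]
  exact (((differentiableAt_snd (𝕜 := ℝ)).fun_pow 4).const_mul (48 : ℝ)).fun_mul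
    ((h1.fun_pow 4).fun_inv h0)

/-- **The derivative of the BPST family in centre and scale** (the flat-space `∂e/∂η` of
Groisser–Murray (metric1)): at `(a, l)`, in the direction `(v, s)`,
`∂_{(v,s)} ρ(x) = 192 l³ (s(‖x−a‖² − l²) + 2l⟪x − a, v⟫)/(l² + ‖x − a‖²)⁵`, as a line derivative.
[folklore] -/
theorem hasLineDerivAt_bpstDensity (a : E4) {l : ℝ} (hl : l ≠ 0) (x v : E4) (s : ℝ) :
    HasLineDerivAt ℝ (fun p : E4 × ℝ ↦ bpstDensity p.1 p.2 x)
      (192 * l ^ 3 * (s * (‖x - a‖ ^ 2 - l ^ 2) + 2 * l * ⟪x - a, v⟫) / (l ^ 2 + ‖x - a‖ ^ 2) ^ 5)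
      (a, l) (v, s) := by
  unfold HasLineDerivAt
  have hexp : ∀ t : ℝ, ‖x - (a + t • v)‖ ^ 2 = ‖x - a‖ ^ 2 - 2 * t * ⟪x - a, v⟫ + t ^ 2 * ‖v‖ ^ 2 := by
    intro t
    rw [show x - (a + t • v) = (x - a) - t • v by abel, norm_sub_sq_real, inner_smul_right, norm_smul,
      Real.norm_eq_abs, mul_pow, sq_abs]
    ring
  -- the derivative of the rational function of `t`
  have h1 : HasDerivAt (fun t : ℝ ↦ l + t * s) (1 * s) 0 :=
    ((hasDerivAt_id' (0 : ℝ)).mul_const s).const_add l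
  have hN : HasDerivAt (fun t : ℝ ↦ 48 * (l + t * s) ^ 4)
      (48 * (↑(4 : ℕ) * (l + 0 * s) ^ (4 - 1) * (1 * s))) 0 :=
    (h1.fun_pow 4).const_mul 48
  have h3 : HasDerivAt (fun t : ℝ ↦ ‖x - a‖ ^ 2 - 2 * t * ⟪x - a, v⟫ + t ^ 2 * ‖v‖ ^ 2)
      (-(2 * 1 * ⟪x - a, v⟫) + ↑(2 : ℕ) * (0 : ℝ) ^ (2 - 1) * ‖v‖ ^ 2) 0 :=
    ((((hasDerivAt_id' (0 : ℝ)).const_mul 2).mul_const ⟪x - a, v⟫).const_sub (‖x - a‖ ^ 2)).fun_add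
      ((hasDerivAt_pow 2 (0 : ℝ)).mul_const (‖v‖ ^ 2))
  have hQ := (h1.fun_pow 2).fun_add h3
  have hQ0 : (l + 0 * s) ^ 2 + (‖x - a‖ ^ 2 - 2 * 0 * ⟪x - a, v⟫ + (0 : ℝ) ^ 2 * ‖v‖ ^ 2) ≠ 0 := by
    norm_num
    positivity
  have hmain := hN.fun_div (hQ.fun_pow 4) (pow_ne_zero 4 hQ0)
  have hu : l ^ 2 + ‖x - a‖ ^ 2 ≠ 0 := by positivity
  refine (hmain.congr_deriv ?_).congr_of_eventuallyEq (Eventually.of_forall fun t ↦ ?_)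
  · norm_num
    field_simp
    ring
  · simp only [bpstDensity, Prod.smul_mk, Prod.mk_add_mk, smul_eq_mul]
    rw [hexp t]

/-- **The derivative of the BPST family in centre and scale**, Fréchet form:
`D(ρ_{·,·}(x))(a, l)(v, s) = 192 l³ (s(‖x−a‖² − l²) + 2l⟪x − a, v⟫)/(l² + ‖x − a‖²)⁵`. [folklore] -/
theorem fderiv_bpstDensity (a : E4) {l : ℝ} (hl : l ≠ 0) (x v : E4) (s : ℝ) :
    fderiv ℝ (fun p : E4 × ℝ ↦ bpstDensity p.1 p.2 x) (a, l) (v, s) =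
      192 * l ^ 3 * (s * (‖x - a‖ ^ 2 - l ^ 2) + 2 * l * ⟪x - a, v⟫) / (l ^ 2 + ‖x - a‖ ^ 2) ^ 5 := by
  rw [← (differentiableAt_bpstDensity a x hl).lineDeriv_eq_fderiv]
  exact (hasLineDerivAt_bpstDensity a hl x v s).lineDeriv

/-- **The Fisher–Rao (information) metric of the BPST family is the hyperbolic metric of `B⁵`,
with Groisser–Murray's constant:** for `l > 0`, `v ∈ ℝ⁴`, `s ∈ ℝ`,
`∫_{ℝ⁴} (∂_{(v,s)} ρ_{a,l})² / ρ_{a,l} d⁴x = (128π²/5) · (s² + ‖v‖²)/l²`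
— Groisser–Murray 1997, proof of Thm. 3.1, p. 7: the integrand is
`768 l² (s(r²−l²) + 2l⟪y,v⟫)²/(l²+r²)⁶`, the cross term is odd, the two radial integrals are `1/60`,
and `16·48·2π²/60 = 128π²/5`; equivalently the information metric `c(d𝐚² + dλ²)/λ²` of
`M₁(S⁴) = B⁵` (GM 1997 §2, p. 5, after Hitchin). [cite: GroisserMurray1997, §3, proof of Thm. 3.1, p. 7] -/
theorem integral_fisherRao_bpstDensity (a : E4) {l : ℝ} (hl : 0 < l) (v : E4) (s : ℝ) :
    ∫ x : E4, (fderiv ℝ (fun p : E4 × ℝ ↦ bpstDensity p.1 p.2 x) (a, l) (v, s)) ^ 2 / bpstDensity a l x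
      = 128 * π ^ 2 / 5 * (s ^ 2 + ‖v‖ ^ 2) / l ^ 2 := by
  have hl0 : l ≠ 0 := hl.ne'
  -- the integrand, translated to the centre: `768 l² (α + β)²`
  set α : E4 → ℝ := fun y ↦ s * (‖y‖ ^ 2 - l ^ 2) / (l ^ 2 + ‖y‖ ^ 2) ^ 3 with hα
  set β : E4 → ℝ := fun y ↦ 2 * l * ⟪y, v⟫ / (l ^ 2 + ‖y‖ ^ 2) ^ 3 with hβ
  have hune : ∀ y : E4, l ^ 2 + ‖y‖ ^ 2 ≠ 0 := fun y ↦ by positivity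
  have hpt : ∀ x : E4, (fderiv ℝ (fun p : E4 × ℝ ↦ bpstDensity p.1 p.2 x) (a, l) (v, s)) ^ 2 /
      bpstDensity a l x =
        (fun y ↦ 768 * l ^ 2 * (α y) ^ 2 + 768 * l ^ 2 * 2 * (α y * β y) + 768 * l ^ 2 * (β y) ^ 2)
          (-a + x) := by
    intro x
    rw [fderiv_bpstDensity a hl0 x v s, bpstDensity_apply, neg_add_eq_sub]
    simp only [hα, hβ]
    have hu : l ^ 2 + ‖x - a‖ ^ 2 ≠ 0 := by positivity
    field_simp
    ring
  simp_rw [hpt]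
  have htrans := integral_add_left_eq_self (μ := (volume : Measure E4))
    (fun y ↦ 768 * l ^ 2 * (α y) ^ 2 + 768 * l ^ 2 * 2 * (α y * β y) + 768 * l ^ 2 * (β y) ^ 2) (-a)
  rw [htrans]
  -- integrability of the three pieces
  have hcu : Continuous fun y : E4 ↦ l ^ 2 + ‖y‖ ^ 2 := by fun_prop
  have hαc : Continuous α :=
    (continuous_const.mul ((continuous_norm.pow 2).sub continuous_const)).div (hcu.pow 3)
      fun y ↦ pow_ne_zero 3 (hune y)
  have hβc : Continuous β :=
    (continuous_const.mul (continuous_id.inner continuous_const)).div (hcu.pow 3)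
      fun y ↦ pow_ne_zero 3 (hune y)
  have hA : Integrable (fun y : E4 ↦ (‖y‖ ^ 2 - l ^ 2) ^ 2 / (l ^ 2 + ‖y‖ ^ 2) ^ 6) :=
    (integrable_radial_four_iff (fun r ↦ (r ^ 2 - l ^ 2) ^ 2 / (l ^ 2 + r ^ 2) ^ 6)).2
      (integrableOn_radial_sq hl)
  have hM : Integrable (fun y : E4 ↦ ((l ^ 2 + ‖y‖ ^ 2) ^ 6)⁻¹ * ‖y‖ ^ 2) :=
    (integrable_radial_four_iff (fun r ↦ ((l ^ 2 + r ^ 2) ^ 6)⁻¹ * r ^ 2)).2 (integrableOn_moment hl)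
  have hα2 : Integrable (fun y ↦ (α y) ^ 2) := by
    refine (hA.const_mul (s ^ 2)).congr (ae_of_all _ fun y ↦ ?_)
    simp only [hα]
    have := hune y
    field_simp
  have hβ2 : Integrable (fun y ↦ (β y) ^ 2) := by
    refine (hM.const_mul ((2 * l) ^ 2 * ‖v‖ ^ 2)).mono' (hβc.pow 2).aestronglyMeasurable
      (ae_of_all _ fun y ↦ ?_)
    rw [Real.norm_eq_abs, abs_of_nonneg (sq_nonneg _)]
    simp only [hβ]
    have hcs : ⟪y, v⟫ ^ 2 ≤ ‖y‖ ^ 2 * ‖v‖ ^ 2 := by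
      rw [← sq_abs, ← mul_pow]
      exact pow_le_pow_left₀ (abs_nonneg _) (abs_real_inner_le_norm y v) 2
    have hu := hune y
    rw [div_pow, div_le_iff₀ (by positivity)]
    calc (2 * l * ⟪y, v⟫) ^ 2 = (2 * l) ^ 2 * ⟪y, v⟫ ^ 2 := by ring
      _ ≤ (2 * l) ^ 2 * (‖y‖ ^ 2 * ‖v‖ ^ 2) := by gcongr
      _ = (2 * l) ^ 2 * ‖v‖ ^ 2 * (((l ^ 2 + ‖y‖ ^ 2) ^ 6)⁻¹ * ‖y‖ ^ 2) *
          ((l ^ 2 + ‖y‖ ^ 2) ^ 3) ^ 2 := by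
        field_simp
  have hsq : Integrable (fun y ↦ (α y + β y) ^ 2) := by
    refine ((hα2.add hβ2).const_mul 2).mono' ((hαc.add hβc).pow 2).aestronglyMeasurable
      (ae_of_all _ fun y ↦ ?_)
    rw [Real.norm_eq_abs, abs_of_nonneg (sq_nonneg _)]
    simp only [Pi.add_apply]
    nlinarith [sq_nonneg (α y - β y)]
  have hαβ : Integrable (fun y ↦ α y * β y) := by
    refine (((hsq.sub hα2).sub hβ2).div_const 2).congr (ae_of_all _ fun y ↦ ?_)
    simp only [Pi.sub_apply]
    ring
  -- the three integrals
  have hIA : ∫ y : E4, (‖y‖ ^ 2 - l ^ 2) ^ 2 / (l ^ 2 + ‖y‖ ^ 2) ^ 6 = π ^ 2 / (30 * l ^ 4) := by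
    have h := integral_radial_four (fun r ↦ (r ^ 2 - l ^ 2) ^ 2 / (l ^ 2 + r ^ 2) ^ 6)
    rw [h, integral_radial_sq hl]
    field_simp
    ring
  have hIα : ∫ y, (α y) ^ 2 = s ^ 2 * (π ^ 2 / (30 * l ^ 4)) := by
    rw [← hIA, ← integral_const_mul]
    refine integral_congr_ae (ae_of_all _ fun y ↦ ?_)
    simp only [hα]
    have := hune y
    field_simp
  have hIβ : ∫ y, (β y) ^ 2 = 4 * l ^ 2 * (‖v‖ ^ 2 / 4 * (π ^ 2 / (30 * l ^ 6))) := by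
    have hcg : Continuous fun r : ℝ ↦ ((l ^ 2 + r ^ 2) ^ 6)⁻¹ :=
      (Continuous.pow (by fun_prop) 6).inv₀ fun r ↦ pow_ne_zero 6 (by positivity)
    have hiso := integral_norm_mul_inner_sq (fun r ↦ ((l ^ 2 + r ^ 2) ^ 6)⁻¹) hcg v hM
    have hrad := integral_radial_four (fun r ↦ ((l ^ 2 + r ^ 2) ^ 6)⁻¹ * r ^ 2)
    have hmom : ∫ x : E4, ((l ^ 2 + ‖x‖ ^ 2) ^ 6)⁻¹ * ‖x‖ ^ 2 = π ^ 2 / (30 * l ^ 6) := by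
      rw [hrad, integral_moment hl]
      field_simp
      ring
    rw [← hmom, ← hiso, ← integral_const_mul]
    refine integral_congr_ae (ae_of_all _ fun y ↦ ?_)
    simp only [hβ]
    have := hune y
    field_simp
    ring
  have hIαβ : ∫ y, α y * β y = 0 := by
    rw [← integral_norm_mul_inner_eq_zero
      (fun r ↦ s * (r ^ 2 - l ^ 2) / (l ^ 2 + r ^ 2) ^ 3 * (2 * l) / (l ^ 2 + r ^ 2) ^ 3) v]
    refine integral_congr_ae (ae_of_all _ fun y ↦ ?_)
    simp only [hα, hβ]
    ring
  -- assemble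
  have hAB : Integrable (fun y ↦ 768 * l ^ 2 * (α y) ^ 2 + 768 * l ^ 2 * 2 * (α y * β y)) :=
    (hα2.const_mul _).add (hαβ.const_mul _)
  rw [integral_add hAB (hβ2.const_mul _), integral_add (hα2.const_mul _) (hαβ.const_mul _),
    integral_const_mul, integral_const_mul, integral_const_mul, hIα, hIβ, hIαβ]
  field_simp
  ring

end Literature.Geometry.GaugeTheory

end
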